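import Literature.NumberTheory.LFunctions.HyperbolicSeparationKernel
import HarnessLib

/-!
# An exact Mellin separation of the hyperbolic condition `mn ≤ X`: the indicator formula

Second file of the separation-of-variables step of Conrey–Iwaniec, Acta Arith. 103 (2002), §9
p. 20 (see `HyperbolicSeparationKernel.lean`). Everything here is PROVED; no named fact.

For integers `X ≥ 1`, `k ≥ 1` and `c > 0`:
`𝟙_{k ≤ X} = (X+1−k)⁺ − (X−k)⁺ = (1/2π)∫ κ_X(u) k^{−(c+iu)} du`,
`κ_X(u) = ((X+1)^{1+c+iu} − X^{1+c+iu})/((c+iu)(c+iu+1))`, from the Perron kernel of order one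
`(1 − y)⁺ = (1/2π)∫ y^{−(c+iu)} du/((c+iu)(c+1+iu))` (tree `mellinInv_kernel_eq`) at `y = k/Z`,
`Z ∈ {X, X+1}`. This turns `Σ_{mn ≤ X} a_m b_n (mn)^{−s}` into an absolutely convergent average of
products of twisted Dirichlet polynomials `(Σ_m a_m m^{−s−c−iu})(Σ_n b_n n^{−s−c−iu})`.

## References
* [ConreyIwaniec2002] B. Conrey, H. Iwaniec, Acta Arith. 103 (2002) 259–312, §9 p. 20.
* [MontgomeryVaughan2007] H. L. Montgomery, R. C. Vaughan, *Multiplicative Number Theory I*, §5.1.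
-/

noncomputable section

open Complex MeasureTheory Set Real Filter

namespace Literature.NumberTheory.LFunctions

namespace HyperbolicSeparation

/-! ### The exact Mellin representation of `𝟙_{k ≤ X}` -/

/-- For positive reals `k, Z`: `(k/Z)^{−w} = Z^{w} k^{−w}`. [folklore] -/
private theorem div_cpow_neg_eq {k Z : ℝ} (hk : 0 < k) (hZ : 0 < Z) (w : ℂ) :
    ((k : ℂ) / (Z : ℂ)) ^ (-w) = (Z : ℂ) ^ w * (k : ℂ) ^ (-w) := by
  have harg : (Z : ℂ).arg ≠ Real.pi := by
    rw [Complex.arg_ofReal_of_nonneg hZ.le]; exact Real.pi_pos.ne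
  rw [div_eq_mul_inv, ← Complex.ofReal_inv,
    Complex.mul_cpow_ofReal_nonneg hk.le (inv_nonneg.2 hZ.le), Complex.ofReal_inv,
    Complex.inv_cpow _ _ harg, Complex.cpow_neg (Z : ℂ) w, inv_inv, mul_comm]

/-- The integrand `Z^{1+w} k^{−w}/(w(w+1))` (`w = c + iu`, `c > 0`) is integrable in `u`.
[cite: MontgomeryVaughan2007, §5.1 (5.19)–(5.20)] -/
theorem integrable_cpow_mul_cpow_div {k Z c : ℝ} (hk : 0 < k) (hZ : 0 < Z) (hc : 0 < c) :
    Integrable fun u : ℝ =>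
      (Z : ℂ) ^ (1 + ((c : ℂ) + u * I)) / (((c : ℂ) + u * I) * ((c : ℂ) + u * I + 1)) *
        (k : ℂ) ^ (-((c : ℂ) + u * I)) := by
  have hw : Continuous fun u : ℝ => (c : ℂ) + u * I := by fun_prop
  have hZ' : (Z : ℂ) ≠ 0 := by exact_mod_cast hZ.ne'
  have hk' : (k : ℂ) ≠ 0 := by exact_mod_cast hk.ne'
  have hcont : Continuous fun u : ℝ =>
      (Z : ℂ) ^ (1 + ((c : ℂ) + u * I)) / (((c : ℂ) + u * I) * ((c : ℂ) + u * I + 1)) *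
        (k : ℂ) ^ (-((c : ℂ) + u * I)) := by
    refine (Continuous.div ?_ (by fun_prop) fun u => kernelDen_ne_zero hc u).mul ?_
    · exact (continuous_const.add hw).const_cpow (Or.inl hZ')
    · exact hw.neg.const_cpow (Or.inl hk')
  refine ((integrable_inv_sq_add_sq hc).const_mul (Z ^ (1 + c) * k ^ (-c))).mono'
    hcont.aestronglyMeasurable (Eventually.of_forall fun u => ?_)
  rw [norm_mul, norm_div, Complex.norm_cpow_eq_rpow_re_of_pos hZ, Complex.norm_cpow_eq_rpow_re_of_pos hk]
  simp only [add_re, one_re, ofReal_re, mul_re, I_re, mul_zero, ofReal_im, I_im, mul_one,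
    sub_self, add_zero, neg_re]
  have hden := sq_add_sq_le_norm_kernelDen hc.le u
  have hpos : 0 < c ^ 2 + u ^ 2 := by positivity
  rw [div_mul_eq_mul_div, ← div_eq_mul_one_div]
  have hnum : 0 ≤ Z ^ (1 + c) * k ^ (-c) := by positivity
  exact div_le_div_of_nonneg_left hnum hpos hden

/-- **`(Z − k)⁺ = (1/2π)∫ Z^{1+c+iu} k^{−c−iu} du/((c+iu)(c+1+iu))`** for `Z, k > 0`, `c > 0`: the
Perron kernel of order one (tree `mellinInv_kernel_eq`) in the variables `Z, k`.
[cite: MontgomeryVaughan2007, §5.1 (5.19)–(5.20)] -/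
theorem posPart_eq_integral {k Z c : ℝ} (hk : 0 < k) (hZ : 0 < Z) (hc : 0 < c) :
    ((max (Z - k) 0 : ℝ) : ℂ) =
      (1 / (2 * Real.pi) : ℂ) * ∫ u : ℝ,
        (Z : ℂ) ^ (1 + ((c : ℂ) + u * I)) / (((c : ℂ) + u * I) * ((c : ℂ) + u * I + 1)) *
          (k : ℂ) ^ (-((c : ℂ) + u * I)) := by
  have hy : 0 < k / Z := div_pos hk hZ
  have hK := mellinInv_kernel_eq hc hy
  unfold mellinInv at hK
  have hmax : Z * max (1 - k / Z) 0 = max (Z - k) 0 := by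
    rw [mul_max_of_nonneg _ _ hZ.le, mul_sub, mul_one, mul_div_cancel₀ _ hZ.ne', mul_zero]
  have hZ' : (Z : ℂ) ≠ 0 := by exact_mod_cast hZ.ne'
  rw [← hmax, Complex.ofReal_mul, ← hK, Complex.real_smul, ← mul_assoc, mul_comm (Z : ℂ),
    mul_assoc, ← integral_const_mul]
  push_cast
  congr 1
  refine integral_congr_ae (Eventually.of_forall fun u => ?_)
  simp only [smul_eq_mul]
  rw [div_cpow_neg_eq hk hZ, Complex.cpow_add 1 ((c : ℂ) + u * I) hZ', Complex.cpow_one]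
  ring

/-- **The exact separation formula**: for integers `X ≥ 1`, `k ≥ 1` and `c > 0`,
`(1/2π)∫ κ_X(u) k^{−(c+iu)} du = 𝟙_{k ≤ X}`, `κ_X(u) = ((X+1)^{1+w} − X^{1+w})/(w(w+1))`, `w = c+iu`
(`𝟙_{k ≤ X} = (X+1−k)⁺ − (X−k)⁺` on integers). [cite: ConreyIwaniec2002, §9 p. 20 (separation of variables)] -/
theorem integral_kernel_mul_cpow {X k : ℕ} (hX : 1 ≤ X) (hk : 1 ≤ k) {c : ℝ} (hc : 0 < c) :
    (1 / (2 * Real.pi) : ℂ) * ∫ u : ℝ,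
      ((((X : ℝ) + 1 : ℝ) : ℂ) ^ (1 + ((c : ℂ) + u * I)) - ((X : ℝ) : ℂ) ^ (1 + ((c : ℂ) + u * I))) /
        (((c : ℂ) + u * I) * ((c : ℂ) + u * I + 1)) * (k : ℂ) ^ (-((c : ℂ) + u * I)) =
      if k ≤ X then 1 else 0 := by
  have hk0 : (0 : ℝ) < k := by exact_mod_cast hk
  have hX0 : (0 : ℝ) < X := by exact_mod_cast hX
  have hX1 : (0 : ℝ) < (X : ℝ) + 1 := by linarith
  have h1 := posPart_eq_integral hk0 hX1 hc
  have h0 := posPart_eq_integral hk0 hX0 hc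
  have hi1 := integrable_cpow_mul_cpow_div hk0 hX1 hc
  have hi0 := integrable_cpow_mul_cpow_div hk0 hX0 hc
  -- the left side as a difference of positive parts
  have hlhs : (if k ≤ X then (1 : ℂ) else 0) =
      ((max ((X : ℝ) + 1 - k) 0 : ℝ) : ℂ) - ((max ((X : ℝ) - k) 0 : ℝ) : ℂ) := by
    split_ifs with hkX
    · have h : (k : ℝ) ≤ X := by exact_mod_cast hkX
      rw [max_eq_left (by linarith), max_eq_left (by linarith)]
      push_cast; ring
    · have h : (X : ℝ) + 1 ≤ k := by exact_mod_cast (by omega : X + 1 ≤ k)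
      rw [max_eq_right (by linarith), max_eq_right (by linarith)]
      simp
  rw [hlhs, h1, h0, ← mul_sub, ← integral_sub hi1 hi0]
  congr 1
  refine integral_congr_ae (Eventually.of_forall fun u => ?_)
  push_cast
  ring

end HyperbolicSeparation

end Literature.NumberTheory.LFunctions

end
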